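import Literature.NumberTheory.EllipticCurves.BSDHeegnerPointsTorsionProofs
import Literature.NumberTheory.EllipticCurves.ModularSymbolsProofs
import HarnessLib

/-!
# The three-term Atkin–Lehner relation on modular symbols: `{∞, w(Q)·r}_f = ε_Q {∞, r}_f + {∞, w(Q)∞}_f`

Summit `BirchSwinnertonDyer`, route `ManinLocalTwoThree` (cell bsd-f2-manin), deciding crux C2 `ManinOddAtFour`
(stmt-BirchSwinnertonDyer-22967); analytic lens rows E-an-45 `CuspThreeTorsionAtFourExact`, E-an-83 `FourPCuspHexagon`
(MEMO-an §55, §60).  TOOL theorem, general level.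

For `f ∈ S₂(Γ₀(N))`, an exact divisor `Q ∥ N`, the canonical Atkin–Lehner matrix `w(Q) = (Qx, y; N, Q)`
(`atkinLehnerW`, `Qx − (N/Q)y = 1`) with `w_Q f = ε f`, and ANY rational `r` with `w(Q) r ≠ ∞`:
`{∞, w(Q) r}_f = ε {∞, r}_f + {∞, x/(N/Q)}_f` (`modularSymbol_atkinLehnerW_smul`; `x/(N/Q) = w(Q)∞`).  The tree
had the two degenerate cases: `r = w(Q)⁻¹∞` (the «flip» `{∞, u/m} = −ε{∞, v/m}`,
`modularSymbol_div_eq_neg_mul_atkinLehner`) and the Eichler-integral form at points of `ℍ`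
(`eichlerIntegral_atkinLehnerW_smul`: `V_f(w(Q)τ) = ε V_f(τ) + {∞, x/(N/Q)}_f`).  PROOF (exact, no limits): with
`δ_r, δ_s ∈ SL(2, ℤ)` moving `∞` to `r` and to `s = w(Q) r`, the matrix `g = δ_s⁻¹ w(Q) δ_r` fixes `∞`, i.e. is upper
triangular, and for upper-triangular `g` the vertical-ray integral satisfies `V_{φ ∣ g}(τ) = V_φ(g τ)` (affine
substitution, `verticalIntegral_slash_of_apply_one_zero_eq_zero`); Manin's decomposition
`{∞, δ∞}_f = V_f(δ τ) − V_{f ∣ δ}(τ)` (`modularSymbol_smul_infty`) at `δ_s` with base point `g τ` and at `δ_r` with base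
point `τ`, together with `f ∣ w(Q) = ε f`, then gives the relation.
Nothing about BSD, Manin's conjecture or any Manin constant is asserted or proved here.
-/

-- `Summit.BirchSwinnertonDyer.BirchSwinnertonDyer` is the mandated summit-side namespace (single-conjunct summit).
set_option linter.dupNamespace false

noncomputable section

open scoped MatrixGroups ModularForm
open CongruenceSubgroup Matrix.SpecialLinearGroup UpperHalfPlane Complex MeasureTheory Set
open Literature.NumberTheory.EllipticCurves.ModularForms

namespace Summit.BirchSwinnertonDyer.BirchSwinnertonDyer.Theorems.ManinLocalTwoThree

/-! ### Vertical-ray integrals under an upper-triangular matrix -/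

/-- An upper-triangular `g = (a b; 0 d) ∈ GL(2, ℝ)⁺` maps the vertical ray above `τ` affinely onto the vertical ray
above `g τ`: `g (τ + it) = g τ + i (a/d) t`. [folklore] -/
theorem upperTriangular_smul_ofComplex {g : GL (Fin 2) ℝ} (hg : g 1 0 = 0) (hdet : 0 < g.det.val)
    (τ : ℍ) {t : ℝ} (ht : 0 < t) :
    g • ofComplex ((τ : ℂ) + t * Complex.I) =
      ofComplex (((g • τ : ℍ) : ℂ) + ((g 0 0 / g 1 1 * t : ℝ) : ℂ) * Complex.I) := by
  have hdet' : g.det.val = g 0 0 * g 1 1 := by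
    rw [Matrix.GeneralLinearGroup.val_det_apply, Matrix.det_fin_two]
    simp [hg]
  have hprod : 0 < g 0 0 * g 1 1 := hdet' ▸ hdet
  have hd0 : (g 1 1 : ℝ) ≠ 0 := fun h ↦ by rw [h, mul_zero] at hprod; exact lt_irrefl _ hprod
  have hratio : 0 < g 0 0 / g 1 1 := by
    have h1 : g 0 0 / g 1 1 = g 0 0 * g 1 1 / (g 1 1 * g 1 1) := by field_simp
    rw [h1]; exact div_pos hprod (mul_self_pos.mpr hd0)
  have him : 0 < ((τ : ℂ) + t * Complex.I).im := by simpa using add_pos τ.im_pos ht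
  have him' : 0 < (((g • τ : ℍ) : ℂ) + ((g 0 0 / g 1 1 * t : ℝ) : ℂ) * Complex.I).im := by
    have h1 : (((g • τ : ℍ) : ℂ) + ((g 0 0 / g 1 1 * t : ℝ) : ℂ) * Complex.I).im =
        (g • τ : ℍ).im + g 0 0 / g 1 1 * t := by
      simp [add_im, mul_im, ofReal_re, ofReal_im]
    rw [h1]; exact add_pos (g • τ).im_pos (mul_pos hratio ht)
  apply UpperHalfPlane.ext
  rw [ofComplex_apply_of_im_pos him']
  change _ = ((g • τ : ℍ) : ℂ) + ((g 0 0 / g 1 1 * t : ℝ) : ℂ) * Complex.I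
  rw [coe_smul_of_det_pos hdet, coe_smul_of_det_pos hdet, ofComplex_apply_of_im_pos him]
  change ((g 0 0 : ℂ) * ((τ : ℂ) + t * Complex.I) + g 0 1) / ((g 1 0 : ℂ) * ((τ : ℂ) + t * Complex.I) + g 1 1) =
    ((g 0 0 : ℂ) * (τ : ℂ) + g 0 1) / ((g 1 0 : ℂ) * (τ : ℂ) + g 1 1) + _
  rw [hg]
  push_cast
  ring

/-- **`V_{φ ∣₂ g}(τ) = V_φ(g τ)` for upper-triangular `g ∈ GL(2, ℝ)⁺`**: the weight-`2` factor
`det(g)/d² = a/d` is exactly the Jacobian of the affine substitution `s = (a/d) t` along the ray. [folklore] -/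
theorem verticalIntegral_slash_of_apply_one_zero_eq_zero (φ : ℍ → ℂ) {g : GL (Fin 2) ℝ} (hg : g 1 0 = 0)
    (hdet : 0 < g.det.val) (τ : ℍ) :
    verticalIntegral (φ ∣[(2 : ℤ)] g) τ = verticalIntegral φ (g • τ) := by
  have hdet' : g.det.val = g 0 0 * g 1 1 := by
    rw [Matrix.GeneralLinearGroup.val_det_apply, Matrix.det_fin_two]
    simp [hg]
  have hprod : 0 < g 0 0 * g 1 1 := hdet' ▸ hdet
  have hd0 : (g 1 1 : ℝ) ≠ 0 := fun h ↦ by rw [h, mul_zero] at hprod; exact lt_irrefl _ hprod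
  have ha0 : (g 0 0 : ℝ) ≠ 0 := fun h ↦ by rw [h, zero_mul] at hprod; exact lt_irrefl _ hprod
  have hratio : 0 < g 0 0 / g 1 1 := by
    have h1 : g 0 0 / g 1 1 = g 0 0 * g 1 1 / (g 1 1 * g 1 1) := by field_simp
    rw [h1]; exact div_pos hprod (mul_self_pos.mpr hd0)
  set c : ℝ := g 0 0 / g 1 1 with hc
  set G : ℝ → ℂ := fun s ↦ φ (ofComplex (((g • τ : ℍ) : ℂ) + s * Complex.I)) with hG
  unfold verticalIntegral
  congr 1
  have hdenom : ∀ w : ℍ, denom g w = (g 1 1 : ℂ) := fun w ↦ by rw [denom, hg]; simp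
  have hstep : ∫ t in Ioi (0 : ℝ), (φ ∣[(2 : ℤ)] g) (ofComplex ((τ : ℂ) + t * Complex.I)) =
      ∫ t in Ioi (0 : ℝ), (c : ℂ) * G (c * t) := by
    refine setIntegral_congr_fun measurableSet_Ioi fun t ht ↦ ?_
    rw [ModularForm.slash_apply, σ_eq_self hdet, hdenom, upperTriangular_smul_ofComplex hg hdet τ ht,
      abs_of_pos hdet, hdet', show ((2 : ℤ) - 1) = 1 by norm_num, zpow_one, zpow_neg, hG, hc]
    have hd0' : ((g 1 1 : ℝ) : ℂ) ≠ 0 := by exact_mod_cast hd0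
    have ha0' : ((g 0 0 : ℝ) : ℂ) ≠ 0 := by exact_mod_cast ha0
    push_cast
    field_simp
  rw [hstep, integral_const_mul, integral_comp_mul_left_Ioi G 0 hratio, mul_zero, Complex.real_smul,
    ← mul_assoc, ofReal_inv, mul_inv_cancel₀ (by exact_mod_cast hratio.ne' : (c : ℂ) ≠ 0), one_mul]

/-- `V_{c • φ} = c · V_φ`. [folklore] -/
theorem verticalIntegral_const_smul (c : ℂ) (φ : ℍ → ℂ) (τ : ℍ) :
    verticalIntegral (c • φ) τ = c * verticalIntegral φ τ := by
  unfold verticalIntegral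
  simp only [Pi.smul_apply, smul_eq_mul]
  rw [integral_const_mul]
  ring

/-! ### The three-term relation -/

variable {N : ℕ} [NeZero N] {Q : ℕ} [NeZero Q]

/-- **The three-term Atkin–Lehner relation, matrix form.**  Let `Q ∥ N`, `w_Q f = ε f`, and `δ, δ' ∈ SL(2, ℤ)` with
`δ∞ = r`, `δ'∞ = s` finite cusps such that `δ'⁻¹ w(Q) δ` fixes `∞` (i.e. `s = w(Q) r`).  Then
`{∞, s}_f = ε {∞, r}_f + {∞, w(Q)∞}_f`. [cite: Manin1972, Prop. 1.4] [cite: Knapp1993, Lemma 9.24] -/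
theorem modularSymbol_eq_of_atkinLehnerW_conj (hQN : Q ∣ N) (hc : Nat.Coprime Q (N / Q))
    {f : CuspForm (Gamma0 N) 2} {ε : ℂ} (hε : atkinLehnerInvolution N 2 Q f = ε • f)
    (δ δ' : SL(2, ℤ)) (hδ : (δ 1 0 : ℤ) ≠ 0) (hδ' : (δ' 1 0 : ℤ) ≠ 0)
    (h10 : ((mapGL ℝ δ')⁻¹ * glCast (atkinLehnerW N Q : GL (Fin 2) ℚ) * mapGL ℝ δ) 1 0 = 0) :
    modularSymbol f (((δ' 0 0 : ℤ) : ℚ) / ((δ' 1 0 : ℤ) : ℚ)) =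
      ε * modularSymbol f (((δ 0 0 : ℤ) : ℚ) / ((δ 1 0 : ℤ) : ℚ)) +
        modularSymbol f ((atkinLehnerSL N Q 0 0 : ℚ) / (N / Q : ℕ)) := by
  set W : GL (Fin 2) ℝ := glCast (atkinLehnerW N Q : GL (Fin 2) ℚ) with hW
  set g : GL (Fin 2) ℝ := (mapGL ℝ δ')⁻¹ * W * mapGL ℝ δ with hgdef
  have hdetSL : ∀ γ : SL(2, ℤ), (mapGL ℝ γ).det.val = 1 := fun γ ↦ by
    rw [Matrix.GeneralLinearGroup.val_det_apply, val_mapGL']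
    have h := γ.prop
    rw [Matrix.det_fin_two] at h ⊢
    simp only [Matrix.map_apply]
    exact_mod_cast h
  have hgdet : 0 < g.det.val := by
    rw [hgdef, map_mul, map_mul, map_inv, Units.val_mul, Units.val_mul, Units.val_inv_eq_inv_val, hdetSL,
      hdetSL, hW, det_glCast_atkinLehnerW]
    simp [NeZero.pos Q]
  set τ : ℍ := UpperHalfPlane.I
  -- Manin's decomposition at `δ'` (base point `g τ`) and at `δ` (base point `τ`)
  have E' := modularSymbol_smul_infty f δ' hδ' (g • τ)
  have E := modularSymbol_smul_infty f δ hδ τ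
  -- `δ' (g τ) = w(Q) (δ τ)`
  have hpt : ((δ' : SL(2, ℤ)) • (g • τ) : ℍ) = W • ((δ : SL(2, ℤ)) • τ) := by
    change mapGL ℝ δ' • (g • τ) = W • (mapGL ℝ δ • τ)
    rw [← mul_smul, ← mul_smul, hgdef, ← mul_assoc, ← mul_assoc, mul_inv_cancel, one_mul]
  -- `V_{f ∣ δ'}(g τ) = V_{f ∣ δ' g}(τ) = V_{f ∣ w(Q) δ}(τ) = ε V_{f ∣ δ}(τ)`
  have hslashW : (⇑f ∣[(2 : ℤ)] W) = ε • (⇑f : ℍ → ℂ) := by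
    ext z
    rw [hW, slash_atkinLehnerW_apply hQN hc hε z, Pi.smul_apply, smul_eq_mul]
  have hV : verticalIntegral (⇑f ∣[(2 : ℤ)] δ') (g • τ) = ε * verticalIntegral (⇑f ∣[(2 : ℤ)] δ) τ := by
    rw [← verticalIntegral_slash_of_apply_one_zero_eq_zero _ h10 hgdet]
    have hfun : (⇑f ∣[(2 : ℤ)] δ') ∣[(2 : ℤ)] g = ε • (⇑f ∣[(2 : ℤ)] δ) := by
      change (⇑f ∣[(2 : ℤ)] mapGL ℝ δ') ∣[(2 : ℤ)] g = ε • (⇑f ∣[(2 : ℤ)] mapGL ℝ δ)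
      rw [← SlashAction.slash_mul, hgdef, ← mul_assoc, ← mul_assoc, mul_inv_cancel, one_mul,
        SlashAction.slash_mul, hslashW, ModularForm.smul_slash, σ_eq_self (by rw [hdetSL]; exact one_pos)]
    rw [hfun, verticalIntegral_const_smul]
  have hK := eichlerIntegral_atkinLehnerW_smul hQN hc hε ((δ : SL(2, ℤ)) • τ)
  rw [← hW] at hK
  rw [E', hpt, hV, E, hK]
  ring

/-- **The three-term Atkin–Lehner relation on modular symbols.**  For `Q ∥ N`, `w_Q f = ε f` and `r ∈ ℚ` with
`N r + Q ≠ 0` (`w(Q) r ≠ ∞`), writing `w(Q) = (Qx, y; N, Q)` (`x = β(Q)₀₀`, `y = β(Q)₀₁`):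
`{∞, (Qx r + y)/(N r + Q)}_f = ε {∞, r}_f + {∞, x/(N/Q)}_f`.  The constant `{∞, x/(N/Q)}_f = {∞, w(Q)∞}_f` is the
same for all `r`; at `r = w(Q)⁻¹∞` the left side vanishes (the tree's «flip»
`modularSymbol_div_eq_neg_mul_atkinLehner`). [cite: Manin1972, Prop. 1.4] [cite: Knapp1993, Lemma 9.24] -/
theorem modularSymbol_atkinLehnerW_smul (hQN : Q ∣ N) (hc : Nat.Coprime Q (N / Q))
    {f : CuspForm (Gamma0 N) 2} {ε : ℂ} (hε : atkinLehnerInvolution N 2 Q f = ε • f) (r : ℚ)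
    (hr : (N : ℚ) * r + Q ≠ 0) :
    modularSymbol f (((Q : ℚ) * (atkinLehnerSL N Q 0 0 : ℚ) * r + (atkinLehnerSL N Q 0 1 : ℚ)) /
        ((N : ℚ) * r + Q)) =
      ε * modularSymbol f r + modularSymbol f ((atkinLehnerSL N Q 0 0 : ℚ) / (N / Q : ℕ)) := by
  set x : ℤ := atkinLehnerSL N Q 0 0 with hx
  set y : ℤ := atkinLehnerSL N Q 0 1 with hy
  set s : ℚ := ((Q : ℚ) * x * r + y) / ((N : ℚ) * r + Q) with hs
  set δ : SL(2, ℤ) := cuspMatrix r with hδdef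
  set δ' : SL(2, ℤ) := cuspMatrix s with hδ'def
  have hδ := cuspMatrix_apply_one_zero_ne_zero r
  have hδ' := cuspMatrix_apply_one_zero_ne_zero s
  have hrdiv : ((δ 0 0 : ℤ) : ℚ) / ((δ 1 0 : ℤ) : ℚ) = r := cuspMatrix_div r
  have hsdiv : ((δ' 0 0 : ℤ) : ℚ) / ((δ' 1 0 : ℤ) : ℚ) = s := cuspMatrix_div s
  have key := modularSymbol_eq_of_atkinLehnerW_conj hQN hc hε δ δ' hδ hδ' ?_
  · rwa [hrdiv, hsdiv] at key
  -- the `(1,0)` entry of `δ'⁻¹ w(Q) δ` vanishes because `s = w(Q) r`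
  obtain ⟨h10N, h11Q⟩ := atkinLehnerSL_apply_one N Q hc
  have hNQ : (((N / Q : ℕ) : ℤ) : ℝ) * Q = N := by exact_mod_cast Nat.div_mul_cancel hQN
  -- `δ₀₀ = r δ₁₀`, `δ'₀₀ = s δ'₁₀`, `s (N r + Q) = Q x r + y`
  have hc0 : ((δ 1 0 : ℤ) : ℚ) ≠ 0 := by exact_mod_cast hδ
  have hc0' : ((δ' 1 0 : ℤ) : ℚ) ≠ 0 := by exact_mod_cast hδ'
  have hδ00 : ((δ 0 0 : ℤ) : ℚ) = r * ((δ 1 0 : ℤ) : ℚ) := by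
    rw [← hrdiv, div_mul_cancel₀ _ hc0]
  have hδ'00 : ((δ' 0 0 : ℤ) : ℚ) = s * ((δ' 1 0 : ℤ) : ℚ) := by
    rw [← hsdiv, div_mul_cancel₀ _ hc0']
  have hsR : s * ((N : ℚ) * r + Q) = (Q : ℚ) * x * r + y := by
    rw [hs, div_mul_cancel₀ _ hr]
  have hrel : ((δ' 0 0 : ℤ) : ℚ) * ((N : ℚ) * (δ 0 0 : ℤ) + Q * (δ 1 0 : ℤ)) =
      ((δ' 1 0 : ℤ) : ℚ) * ((Q : ℚ) * x * (δ 0 0 : ℤ) + y * (δ 1 0 : ℤ)) := by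
    rw [hδ00, hδ'00]
    linear_combination (((δ' 1 0 : ℤ) : ℚ) * ((δ 1 0 : ℤ) : ℚ)) * hsR
  have hrelR : ((δ' 0 0 : ℤ) : ℝ) * ((N : ℝ) * (δ 0 0 : ℤ) + Q * (δ 1 0 : ℤ)) =
      ((δ' 1 0 : ℤ) : ℝ) * ((Q : ℝ) * x * (δ 0 0 : ℤ) + y * (δ 1 0 : ℤ)) := by
    have h := congrArg (fun q : ℚ ↦ (q : ℝ)) hrel
    push_cast at h
    exact h
  -- the `(1,0)` entry of the triple product
  rw [Matrix.GeneralLinearGroup.coe_mul, Matrix.GeneralLinearGroup.coe_mul, ← map_inv, val_mapGL',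
    val_mapGL', Matrix.SpecialLinearGroup.coe_inv, Matrix.adjugate_fin_two,
    val_glCast_atkinLehnerW N Q hQN hc]
  simp only [Matrix.mul_apply, Fin.sum_univ_two, Matrix.map_apply, Matrix.of_apply, Matrix.cons_val',
    Matrix.cons_val_zero, Matrix.cons_val_one, Matrix.empty_val', Matrix.cons_val_fin_one, ← hx, ← hy]
  push_cast
  linear_combination hrelR

end Summit.BirchSwinnertonDyer.BirchSwinnertonDyer.Theorems.ManinLocalTwoThree

end
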